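import Literature.NumberTheory.EllipticCurves.HalfIntegralWeightTranslation
import Mathlib.RingTheory.RootsOfUnity.Complex
import HarnessLib

/-!
# Residue-class projections of `q`-expansions on `S_{k/2}(128, χ)`

Second half of the translation infrastructure for the Cohen–Oesterlé input of Tunnell's
Theorem 2 (`S_{3/2}(128, χ₂) = span {g θ₁, g θ₄, g θ₁₆}`, Tunnell 1983, p. 327). For a character
`χ` modulo `128` that is periodic modulo `16` (e.g. Tunnell's `χ₂`), the translates
`f(· + j/8)` of `f ∈ S_{k/2}(128, χ)` stay in the space (`HalfIntegralWeightTranslation`), hence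
so do the **class projections**

  `P_r f (z) = ⅛ ∑_{j mod 8} ζ₈^{-rj} f(z + j/8)`      (`classProj r f`),

whose `q`-expansions retain exactly the coefficients `aₙ`, `n ≡ r (mod 8)`, of `f = ∑ aₙ qⁿ`:

* `classProj_mem_halfIntCuspForms` / `_halfIntModularForms` — `P_r f` lies in the space;
* `hasSum_classProj`, `qCoeffs_classProj` — `P_r f = ∑_{n ≡ r (8)} aₙ qⁿ`;
* `sum_classProj` — `∑_{r mod 8} P_r f = f`;
* `classProj_vadd_eighth` — `P_r f (z + 1/8) = ζ₈^r P_r f (z)` (the support condition as an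
  eigen-property under the translation by `1/8`);
* `classProj_eq_self_of_qCoeffs` — if the coefficients of `f` are already supported on the class of
  `r`, then `P_r f = f`, so `f(z + 1/8) = ζ₈^r f(z)` (`vadd_eighth_of_qCoeffs`).

The finite Fourier analysis is the orthogonality `∑_{j mod 8} ζ₈^{(n-r)j} = 8 [n ≡ r (8)]`
(`sum_zeta8_pow_mul_inv`). No statement of the tree is used unproved; no new named facts.

## References

* J. B. Tunnell, *A classical Diophantine problem and modular forms of weight 3/2*, Invent. Math.
  72 (1983) 323–334, p. 327 (forms supported on residue classes modulo `8`). [Tunnell1983Congruent]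
* G. Shimura, *On modular forms of half integral weight*, Ann. of Math. 97 (1973) 440–481, §1.
  [Shimura1973HalfIntegral]
-/

noncomputable section

open UpperHalfPlane hiding I
open Complex Filter Topology Finset
open scoped MatrixGroups Real Manifold

namespace Literature.NumberTheory.EllipticCurves.Tunnell1983

open Literature.NumberTheory.EllipticCurves.ModularForms

/-! ### Orthogonality of the eighth roots of unity -/

/-- `ζ₈` is a primitive eighth root of unity. [folklore] -/
theorem isPrimitiveRoot_zeta8 : IsPrimitiveRoot zeta8 8 := by
  have := Complex.isPrimitiveRoot_exp 8 (by norm_num)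
  simpa [zeta8] using this

/-- `ζ₈^n = ζ₈^{n mod 8}`. [folklore] -/
theorem zeta8_pow_eq_pow_mod (n : ℕ) : zeta8 ^ n = zeta8 ^ (n % 8) := by
  conv_lhs => rw [← Nat.div_add_mod n 8, pow_add, pow_mul, zeta8_pow_eight, one_pow, one_mul]

/-- `ζ₈^n = ζ₈^r` iff `n ≡ r (mod 8)`. [folklore] -/
theorem zeta8_pow_eq_pow_iff (n r : ℕ) : zeta8 ^ n = zeta8 ^ r ↔ n % 8 = r % 8 := by
  rw [zeta8_pow_eq_pow_mod n, zeta8_pow_eq_pow_mod r]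
  constructor
  · intro h
    exact isPrimitiveRoot_zeta8.pow_inj (Nat.mod_lt n (by norm_num)) (Nat.mod_lt r (by norm_num)) h
  · intro h
    rw [h]

/-- **Orthogonality**: `∑_{j<8} ζ₈^{nj} (ζ₈^{rj})⁻¹ = 8 [n ≡ r (mod 8)]`. [folklore] -/
theorem sum_zeta8_pow_mul_inv (n r : ℕ) :
    ∑ j ∈ range 8, zeta8 ^ (n * j) * (zeta8 ^ (r * j))⁻¹ = if n % 8 = r % 8 then 8 else 0 := by
  set ω : ℂ := zeta8 ^ n * (zeta8 ^ r)⁻¹ with hω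
  have hterm : ∀ j, zeta8 ^ (n * j) * (zeta8 ^ (r * j))⁻¹ = ω ^ j := fun j ↦ by
    rw [hω, mul_pow, inv_pow, ← pow_mul, ← pow_mul]
  rw [sum_congr rfl fun j _ ↦ hterm j]
  have hr0 : zeta8 ^ r ≠ 0 := pow_ne_zero _ zeta8_ne_zero
  by_cases h : n % 8 = r % 8
  · rw [if_pos h]
    have hω1 : ω = 1 := by
      rw [hω, (zeta8_pow_eq_pow_iff n r).mpr h, mul_inv_cancel₀ hr0]
    rw [hω1]
    simp
  · rw [if_neg h]
    have hω1 : ω ≠ 1 := by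
      intro h1
      apply h
      rw [← zeta8_pow_eq_pow_iff]
      rw [hω] at h1
      have := congrArg (· * zeta8 ^ r) h1
      simpa [inv_mul_cancel_right₀ hr0] using this
    have hω8 : ω ^ 8 = 1 := by
      rw [hω, mul_pow, inv_pow, ← pow_mul, ← pow_mul, mul_comm n 8, mul_comm r 8, pow_mul,
        pow_mul, zeta8_pow_eight, one_pow, one_pow, inv_one, mul_one]
    rw [geom_sum_eq hω1, hω8, sub_self, zero_div]

/-! ### Translates and class projections -/

/-- The translate `f(· + j/8)`. [folklore] -/
def translateEighth (j : ℕ) (f : ℍ → ℂ) : ℍ → ℂ := fun z ↦ f (((j : ℝ) * 8⁻¹ : ℝ) +ᵥ z)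

/-- **The class projection `P_r f (z) = ⅛ ∑_{j<8} ζ₈^{-rj} f(z + j/8)`.** [folklore] -/
def classProj (r : ℕ) (f : ℍ → ℂ) : ℍ → ℂ :=
  ∑ j ∈ range 8, ((8 : ℂ)⁻¹ * (zeta8 ^ (r * j))⁻¹) • translateEighth j f

/-- Pointwise formula for `P_r f`. [folklore] -/
theorem classProj_apply (r : ℕ) (f : ℍ → ℂ) (z : ℍ) :
    classProj r f z = ∑ j ∈ range 8, (8 : ℂ)⁻¹ * (zeta8 ^ (r * j))⁻¹ * f (((j : ℝ) * 8⁻¹ : ℝ) +ᵥ z) := by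
  simp only [classProj, translateEighth, Finset.sum_apply, Pi.smul_apply, smul_eq_mul]

variable {k : ℕ} {χ : DirichletCharacter ℂ 128}

/-- `P_r f ∈ S_{k/2}(128, χ)` for `f ∈ S_{k/2}(128, χ)` and `χ` periodic modulo `16`. [folklore] -/
theorem classProj_mem_halfIntCuspForms
    (hχ : ∀ d e : ℤ, χ (((d - 16 * e : ℤ)) : ZMod 128) = χ ((d : ℤ) : ZMod 128))
    {f : ℍ → ℂ} (hf : f ∈ halfIntCuspForms k 128 χ) (r : ℕ) :
    classProj r f ∈ halfIntCuspForms k 128 χ := by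
  unfold classProj
  refine Submodule.sum_mem _ fun j _ ↦ Submodule.smul_mem _ _ ?_
  exact vadd_eighth_mul_mem_halfIntCuspForms hχ hf j

/-- `P_r f ∈ M_{k/2}(128, χ)` for `f ∈ M_{k/2}(128, χ)` and `χ` periodic modulo `16`. [folklore] -/
theorem classProj_mem_halfIntModularForms
    (hχ : ∀ d e : ℤ, χ (((d - 16 * e : ℤ)) : ZMod 128) = χ ((d : ℤ) : ZMod 128))
    {f : ℍ → ℂ} (hf : f ∈ halfIntModularForms k 128 χ) (r : ℕ) :
    classProj r f ∈ halfIntModularForms k 128 χ := by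
  unfold classProj
  refine Submodule.sum_mem _ fun j _ ↦ Submodule.smul_mem _ _ ?_
  exact vadd_eighth_mul_mem_halfIntModularForms hχ hf j

/-! ### `q`-expansions of translates and of the class projections -/

/-- `q(z + j/8) = ζ₈^j q(z)`. [folklore] -/
theorem qParam_vadd_eighth_mul (j : ℕ) (z : ℍ) :
    Function.Periodic.qParam 1 ((((j : ℝ) * 8⁻¹ : ℝ) +ᵥ z : ℍ) : ℂ) =
      zeta8 ^ j * Function.Periodic.qParam 1 (z : ℂ) := by
  rw [qParam_one_eq, qParam_one_eq, coe_vadd, zeta8, ← Complex.exp_nat_mul, ← Complex.exp_add]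
  congr 1
  push_cast
  ring

/-- **`q`-expansion of a translate**: if `f = ∑ aₙ qⁿ` then `f(z + j/8) = ∑ aₙ ζ₈^{nj} q(z)ⁿ`.
[folklore] -/
theorem hasSum_translateEighth {f : ℍ → ℂ} {a : ℕ → ℂ}
    (hf : ∀ τ : ℍ, HasSum (fun n ↦ a n * Function.Periodic.qParam 1 τ ^ n) (f τ)) (j : ℕ) (z : ℍ) :
    HasSum (fun n ↦ a n * zeta8 ^ (n * j) * Function.Periodic.qParam 1 z ^ n)
      (f (((j : ℝ) * 8⁻¹ : ℝ) +ᵥ z)) := by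
  refine (hf (((j : ℝ) * 8⁻¹ : ℝ) +ᵥ z)).congr_fun fun n ↦ ?_
  rw [qParam_vadd_eighth_mul, mul_pow, ← pow_mul, mul_comm j n]
  ring

/-- **`q`-expansion of the class projection**: `P_r f = ∑_{n ≡ r (8)} aₙ qⁿ`. [folklore] -/
theorem hasSum_classProj {f : ℍ → ℂ} {a : ℕ → ℂ}
    (hf : ∀ τ : ℍ, HasSum (fun n ↦ a n * Function.Periodic.qParam 1 τ ^ n) (f τ)) (r : ℕ) (z : ℍ) :
    HasSum (fun n ↦ (if n % 8 = r % 8 then a n else 0) * Function.Periodic.qParam 1 z ^ n)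
      (classProj r f z) := by
  rw [classProj_apply]
  have h := hasSum_sum (s := range 8)
    (f := fun (j : ℕ) (n : ℕ) ↦ (8 : ℂ)⁻¹ * (zeta8 ^ (r * j))⁻¹ *
      (a n * zeta8 ^ (n * j) * Function.Periodic.qParam 1 z ^ n))
    (a := fun j ↦ (8 : ℂ)⁻¹ * (zeta8 ^ (r * j))⁻¹ * f (((j : ℝ) * 8⁻¹ : ℝ) +ᵥ z))
    (fun j _ ↦ (hasSum_translateEighth hf j z).mul_left _)
  have key : ∀ n : ℕ, ∑ j ∈ range 8, (8 : ℂ)⁻¹ * (zeta8 ^ (r * j))⁻¹ *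
        (a n * zeta8 ^ (n * j) * Function.Periodic.qParam 1 z ^ n) =
      (if n % 8 = r % 8 then a n else 0) * Function.Periodic.qParam 1 z ^ n := by
    intro n
    have hsum := sum_zeta8_pow_mul_inv n r
    calc ∑ j ∈ range 8, (8 : ℂ)⁻¹ * (zeta8 ^ (r * j))⁻¹ *
          (a n * zeta8 ^ (n * j) * Function.Periodic.qParam 1 z ^ n)
        = (8 : ℂ)⁻¹ * (∑ j ∈ range 8, zeta8 ^ (n * j) * (zeta8 ^ (r * j))⁻¹) *
            (a n * Function.Periodic.qParam 1 z ^ n) := by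
          rw [mul_sum, sum_mul]
          exact sum_congr rfl fun j _ ↦ by ring
      _ = (if n % 8 = r % 8 then a n else 0) * Function.Periodic.qParam 1 z ^ n := by
          rw [hsum]
          split_ifs <;> ring
  exact h.congr_fun fun n ↦ (key n).symm

/-- **The coefficients of `P_r f`**: `aₙ(P_r f) = aₙ(f)` if `n ≡ r (mod 8)`, else `0`
(`f ∈ M_{k/2}(128, χ)`). [folklore] -/
theorem qCoeffs_classProj {f : ℍ → ℂ} (hf : f ∈ halfIntModularForms k 128 χ) (r : ℕ) :
    qCoeffs (classProj r f) = fun n ↦ if n % 8 = r % 8 then qCoeffs f n else 0 :=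
  qCoeffs_eq_of_hasSum (hasSum_classProj (hasSum_qCoeffs hf) r)

/-- **`∑_{r<8} P_r f = f`** (pointwise). [folklore] -/
theorem sum_classProj {f : ℍ → ℂ} (hf : f ∈ halfIntModularForms k 128 χ) :
    ∑ r ∈ range 8, classProj r f = f := by
  funext z
  rw [Finset.sum_apply]
  have h := hasSum_sum (s := range 8)
    (f := fun (r : ℕ) (n : ℕ) ↦ (if n % 8 = r % 8 then qCoeffs f n else 0) *
      Function.Periodic.qParam 1 z ^ n)
    (a := fun r ↦ classProj r f z) (fun r _ ↦ hasSum_classProj (hasSum_qCoeffs hf) r z)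
  have h' : HasSum (fun n ↦ qCoeffs f n * Function.Periodic.qParam 1 z ^ n)
      (∑ r ∈ range 8, classProj r f z) := by
    refine h.congr_fun fun n ↦ ?_
    rw [← sum_mul]
    congr 1
    rw [sum_congr rfl fun r hr ↦ by rw [Nat.mod_eq_of_lt (mem_range.mp hr)],
      Finset.sum_ite_eq (range 8) (n % 8) (fun _ ↦ qCoeffs f n),
      if_pos (mem_range.mpr (Nat.mod_lt n (by norm_num)))]
  exact h'.unique (hasSum_qCoeffs hf z)

/-! ### The class projections under the translation by `1/8`; class-supported forms -/

/-- **`P_r f (z + 1/8) = ζ₈^r P_r f (z)`**: the coefficients of `P_r f` live on `n ≡ r (mod 8)`, where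
`ζ₈ⁿ = ζ₈^r`. [folklore] -/
theorem classProj_vadd_eighth {f : ℍ → ℂ} {a : ℕ → ℂ}
    (hf : ∀ τ : ℍ, HasSum (fun n ↦ a n * Function.Periodic.qParam 1 τ ^ n) (f τ)) (r : ℕ) (z : ℍ) :
    classProj r f ((8⁻¹ : ℝ) +ᵥ z) = zeta8 ^ r * classProj r f z := by
  have h1 := hasSum_classProj hf r ((8⁻¹ : ℝ) +ᵥ z)
  have h2 := (hasSum_classProj hf r z).mul_left (zeta8 ^ r)
  refine h1.unique (h2.congr_fun fun n ↦ ?_)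
  have hq : Function.Periodic.qParam 1 (((8⁻¹ : ℝ) +ᵥ z : ℍ) : ℂ) =
      zeta8 * Function.Periodic.qParam 1 (z : ℂ) := by
    simpa using qParam_vadd_eighth_mul 1 z
  rw [hq, mul_pow]
  split_ifs with h
  · rw [(zeta8_pow_eq_pow_iff n r).mpr h]
    ring
  · ring

/-- **A class-supported form is its own class projection**: if `f ∈ M_{k/2}(128, χ)` (`χ` periodic
modulo `16`) has `aₙ(f) = 0` for `n ≢ r (mod 8)`, then `P_r f = f`. [folklore] -/
theorem classProj_eq_self_of_qCoeffs
    (hχ : ∀ d e : ℤ, χ (((d - 16 * e : ℤ)) : ZMod 128) = χ ((d : ℤ) : ZMod 128))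
    {f : ℍ → ℂ} (hf : f ∈ halfIntModularForms k 128 χ) {r : ℕ}
    (hr : ∀ n, n % 8 ≠ r % 8 → qCoeffs f n = 0) : classProj r f = f := by
  have hP := classProj_mem_halfIntModularForms hχ hf r
  have hdiff : classProj r f - f ∈ halfIntModularForms k 128 χ := Submodule.sub_mem _ hP hf
  have hq : qCoeffs (classProj r f - f) = 0 := by
    have h1 : ∀ τ : ℍ, HasSum (fun n ↦ (qCoeffs (classProj r f) n - qCoeffs f n) *
        Function.Periodic.qParam 1 τ ^ n) ((classProj r f - f) τ) := fun τ ↦ by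
      simpa only [sub_mul, Pi.sub_apply] using (hasSum_qCoeffs hP τ).sub (hasSum_qCoeffs hf τ)
    rw [qCoeffs_eq_of_hasSum h1]
    funext n
    rw [qCoeffs_classProj hf, Pi.zero_apply]
    by_cases h : n % 8 = r % 8
    · simp [h]
    · simp [h, hr n h]
  have := eq_zero_of_qCoeffs_eq_zero hdiff hq
  exact sub_eq_zero.mp this

/-- **`f(z + 1/8) = ζ₈^r f(z)` for a class-supported `f ∈ M_{k/2}(128, χ)`** (the support condition
as an eigen-property under the translation `τ = (1 1/8; 0 1)`). [folklore] -/
theorem vadd_eighth_of_qCoeffs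
    (hχ : ∀ d e : ℤ, χ (((d - 16 * e : ℤ)) : ZMod 128) = χ ((d : ℤ) : ZMod 128))
    {f : ℍ → ℂ} (hf : f ∈ halfIntModularForms k 128 χ) {r : ℕ}
    (hr : ∀ n, n % 8 ≠ r % 8 → qCoeffs f n = 0) (z : ℍ) :
    f ((8⁻¹ : ℝ) +ᵥ z) = zeta8 ^ r * f z := by
  have h := classProj_vadd_eighth (hasSum_qCoeffs hf) r z
  rwa [classProj_eq_self_of_qCoeffs hχ hf hr] at h

/-- Iterated: `f(z + j/8) = ζ₈^{rj} f(z)` for a class-supported `f`. [folklore] -/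
theorem vadd_eighth_mul_of_qCoeffs
    (hχ : ∀ d e : ℤ, χ (((d - 16 * e : ℤ)) : ZMod 128) = χ ((d : ℤ) : ZMod 128))
    {f : ℍ → ℂ} (hf : f ∈ halfIntModularForms k 128 χ) {r : ℕ}
    (hr : ∀ n, n % 8 ≠ r % 8 → qCoeffs f n = 0) (j : ℕ) (z : ℍ) :
    f (((j : ℝ) * 8⁻¹ : ℝ) +ᵥ z) = zeta8 ^ (r * j) * f z := by
  induction j generalizing z with
  | zero => simp
  | succ j ih =>
    have e : (((j + 1 : ℕ) : ℝ) * 8⁻¹ : ℝ) = (8⁻¹ : ℝ) + ((j : ℝ) * 8⁻¹) := by push_cast; ring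
    rw [e, ← vadd_vadd, vadd_eighth_of_qCoeffs hχ hf hr, ih,
      show r * (j + 1) = r * j + r by ring, pow_add]
    ring

/-- The coefficients of the class projection are supported on the class. [folklore] -/
theorem qCoeffs_classProj_eq_zero {f : ℍ → ℂ} (hf : f ∈ halfIntModularForms k 128 χ) {r n : ℕ}
    (h : n % 8 ≠ r % 8) : qCoeffs (classProj r f) n = 0 := by
  rw [qCoeffs_classProj hf]
  simp [h]

/-- The coefficients of the class projection on the class are those of `f`. [folklore] -/
theorem qCoeffs_classProj_eq {f : ℍ → ℂ} (hf : f ∈ halfIntModularForms k 128 χ) {r n : ℕ}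
    (h : n % 8 = r % 8) : qCoeffs (classProj r f) n = qCoeffs f n := by
  rw [qCoeffs_classProj hf]
  simp [h]

end Literature.NumberTheory.EllipticCurves.Tunnell1983

end
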